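import Summits.BirchSwinnertonDyer.BirchSwinnertonDyer.Theorems.AdditiveBranchIMCGordTwoRankOneHeegnerKolyvaginSelfTwistUnitsFrame
import HarnessLib

/-!
# Route `AdditiveBranchIMC` (rung K1), crux `GordTwoRankOne` (item 19358): the HEIGHT-FREE
# Heegner–Kolyvagin road — Part 22e: NO FREE LUNCH on the self-twist frame — the Jetchev–Skinner–Wan
# inequality for `(V, ℚ(√−p))` is NECESSARY (it follows from the two LOWER halves, with equality under BSD)
# (cell `bsd-addord`, second prover lane `bsd-addord-k1-c3x`, gen 5; `--supports 19358 --as helper` only)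

HONEST FRAMING. THEOREMS ONLY: no definition, no new named fact, no `sorry`; nothing is booked; BSD is
not proved by any of this; the crux and the planner's support item `SelfTwistJSWIndexBound`
(stmt-BirchSwinnertonDyer-23009, filed 2026-08-27T22:00Z on Part 21c) stay OPEN. Parts 21c / 22b
(p575175, p577019) proved: on the self-twist rows, LOWER(E,p) ⟸ PUBLISHED facts + the JSW inequality
`2·v_p[V(K):ℤP] ≤ v_p #Ш(V/K) + v_p ∏c(V) + v_p ∏c(E) (+ 2·v_p #𝓞_K^×)` for the GOOD ordinary `p*`-twist `V`
over `K = ℚ(√−p)`. THIS FILE is the converse bookkeeping (the self-twist twin of Part 9's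
`…HeegnerKolyvaginNecessity`): by Part 22a's identity the inequality FOLLOWS from LOWER(E,p) (the crux's
output on the row) and LOWER(V,p) (the rank-zero GOOD ORDINARY lower half: Skinner–Urban's direction, in the
tree via BCS 2025 Cor. 1.3.1 / Skinner 2016 Thm. C), with equality as soon as both `BSD(E,p)` and `BSD(V,p)`
hold — so the typed input of the frame is exactly as strong as it must be and no weaker statement could
serve: the frame isolates `LOWER(E,p) ∧ LOWER(V,p) ⟺ JSW(V,K)` modulo UPPER(V) (Wuthrich, PUBLISHED).

* `twist_indexBound_units_of_missingLowerBounds` — generic: `K` imaginary quadratic with the Heegner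
  hypothesis for `N_W` (`p ∣ d_K` allowed), `W` of analytic rank `0`, `Wd = Cd • W^{(d_K)}` of analytic rank
  `1`, `ord_p u(Cd) = 0`: LOWER(W) ∧ LOWER(Wd) ⟹ the inequality with the unit term.
* `selfTwistIndexBound_of_missingLowerBounds` — on the frame (`V` good at `p`, `d_K = −p`): LOWER(E,p) ∧
  LOWER(V,p) ⟹ `2·v_p[V(K):ℤP] ≤ v_p #Ш(V/K) + v_p ∏c(V) + v_p ∏c(E) + 2·v_p #𝓞_K^×`.

References: [JetchevSkinnerWan2017] §7.4.1; [GrossZagier1986] I.(6.5), V.§2; [Miller2011LMS] Def. 1.1.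
-/

set_option autoImplicit false
set_option linter.dupNamespace false
noncomputable section

open scoped Classical NumberField
open WeierstrassCurve NumberField IsDedekindDomain
  Literature.NumberTheory.EllipticCurves Literature.NumberTheory.EllipticCurves.ModularForms
  Literature.NumberTheory.EllipticCurves.Rank1Residual
  Literature.NumberTheory.EllipticCurves.Rank1Residual.Typed
  Summit.BirchSwinnertonDyer.Rank1Residual
  Summit.BirchSwinnertonDyer.Rank1Residual.Additive

namespace Summit.BirchSwinnertonDyer.BirchSwinnertonDyer.Theorems.AdditiveBranchIMCGordTwoRankOne.HeegnerKolyvagin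

/-! ### §9 No free lunch: the JSW inequality for the parametrised rank-zero curve from the two LOWER halves -/

/-- **The JSW inequality (unit term kept) for a rank-zero parametrised curve FOLLOWS from the two LOWER
halves** — `W` of analytic rank `0`, `Wd = Cd • W^{(d_K)}` of analytic rank `1`, `K` imaginary quadratic with
the Heegner hypothesis for `N_W` (`p ∣ d_K` allowed), `p` odd, `p ∤ c(Dt)`, `ord_p u(Cd) = 0`:
`MissingLowerBoundAt W p ∧ MissingLowerBoundAt Wd p ⟹ 2·v_p[W(K):ℤP] ≤ v_p #Ш(W/K) + v_p ∏c(W) + v_p ∏c(Wd)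
+ 2·v_p #𝓞_K^×` (Part 22a's identity read backwards; equality when both lower halves are equalities).
[cite: JetchevSkinnerWan2017, §7.4.1 (eq:gz for K′), pp. 29–30] [cite: Miller2011LMS, Def. 1.1] -/
theorem twist_indexBound_units_of_missingLowerBounds
    (W : WeierstrassCurve ℚ) [W.IsElliptic] [W.IsGloballyMinimal] (p : ℕ) [Fact p.Prime]
    (N : ℕ) [NeZero N] (K : Type) [Field K] [NumberField K]
    (Dt : ModularParametrizationData W N) (H : HeegnerDatum N (NumberField.discr K)) (ι : K →+* ℂ)
    (P : (W.baseChange K).toAffine.Point)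
    (hGZ : gross_zagier N W K) (hKo : kolyvagin N W K)
    (hGZK : rank_eq_analyticRank_of_analyticRank_le_one) (hmod : hasEntireLFunction_rat)
    (hK : IsImaginaryQuadratic K) (hHN : SatisfiesHeegnerHypothesis N K)
    (hP : WeierstrassCurve.Affine.Point.map ι.toRatAlgHom P = heegnerPointComplex Dt H)
    (hp2 : p ≠ 2) (hc : ¬ (p : ℤ) ∣ Dt.c)
    (hr : W.analyticRank = 0) (hLW : Typed.MissingLowerBoundAt W p)
    (Wd : WeierstrassCurve ℚ) [Wd.IsElliptic] [Wd.IsGloballyMinimal] (Cd : VariableChange ℚ)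
    (hWd : Cd • W.quadraticTwist (NumberField.discr K : ℚ) = Wd)
    (hu : padicValRat p (Cd.u : ℚ) = 0) (hrd : Wd.analyticRank = 1) (hLd : Typed.MissingLowerBoundAt Wd p) :
    (2 * padicValNat p (AddSubgroup.zmultiples P).index : ℤ) ≤
      padicValNat p (W.baseChange K).shaOrder + padicValNat p W.tamagawaProduct +
        padicValNat p Wd.tamagawaProduct + 2 * padicValNat p (Units.torsionOrder K) := by
  obtain ⟨q', hq', hlow⟩ := hLW
  obtain ⟨hqW, hvqW⟩ :=
    exists_centralValue_div_realPeriod_eq_of_shaAn_eq_rankZero hGZK hmod W p hr hq'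
  obtain ⟨-, hfinK, hsha, q, hq, hval⟩ := exists_shaAn_twist_padicVal_eq_of_heegner_rankZero_units W p N K
    Dt H ι P hGZ hKo hGZK hmod hK hHN hP hp2 hc hr _ hqW Wd Cd hWd hrd
  obtain ⟨q'', hq'', hlowd⟩ := hLd
  have hqq : q'' = q := by exact_mod_cast hq''.symm.trans hq
  subst hqq
  have e2 : (padicValNat p (W.baseChange K).shaOrder : ℤ) =
      padicValNat p W.shaOrder + padicValNat p Wd.shaOrder := by exact_mod_cast hsha
  rw [hvqW, hu] at hval
  omega

/-- **NO FREE LUNCH ON THE SELF-TWIST FRAME**: `V` good at the odd `p`, `L(V,1) ≠ 0`, `K` imaginary quadratic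
with `d_K = −p` and the Heegner hypothesis for `N_V`, `E = W = Cd • V^{(d_K)}` globally minimal of analytic rank
`1`, a Heegner frame of `V` with `p ∤ c`. THEN LOWER(E,p) (the crux's output on the row) together with LOWER(V,p)
(the rank-zero GOOD ORDINARY lower half) IMPLIES the frame's typed input
`2·v_p[V(K):ℤP] ≤ v_p #Ш(V/K) + v_p ∏c(V) + v_p ∏c(E) + 2·v_p #𝓞_K^×` — the self-twist twin of Part 9
(`…HeegnerKolyvaginNecessity`); for `p ≥ 5` (`#𝓞_K^× = 2`) this is the planner's support item
`SelfTwistJSWIndexBound` (stmt-BirchSwinnertonDyer-23009) read at the frame.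
[cite: JetchevSkinnerWan2017, §7.4.1, pp. 29–31] [cite: SilvermanAEC2009, VII.1 Prop. 1.3(b)]
[cite: Miller2011LMS, Def. 1.1] -/
theorem selfTwistIndexBound_of_missingLowerBounds
    (hGZK : rank_eq_analyticRank_of_analyticRank_le_one) (hmod : hasEntireLFunction_rat)
    (W : WeierstrassCurve ℚ) [W.IsElliptic] [W.IsGloballyMinimal] (p : ℕ) [Fact p.Prime] (hp2 : p ≠ 2)
    (hr : W.analyticRank = 1) (hLW : Typed.MissingLowerBoundAt W p)
    (V : WeierstrassCurve ℚ) [V.IsElliptic] [V.IsGloballyMinimal] (N : ℕ) [NeZero N]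
    (K : Type) [Field K] [NumberField K] (hK : IsImaginaryQuadratic K)
    (hdisc : NumberField.discr K = -(p : ℤ))
    (Cd : VariableChange ℚ) (hCd : Cd • V.quadraticTwist (NumberField.discr K : ℚ) = W)
    (hVgood : V.HasGoodReductionAtPrime p) (hLV : V.entireLFunction 1 ≠ 0) (hLV0 : Typed.MissingLowerBoundAt V p)
    (hHN : SatisfiesHeegnerHypothesis N K) (hGZ : gross_zagier N V K) (hKo : kolyvagin N V K)
    (Dt : ModularParametrizationData V N) (H : HeegnerDatum N (NumberField.discr K)) (ι : K →+* ℂ)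
    (P : (V.baseChange K).toAffine.Point)
    (hP : WeierstrassCurve.Affine.Point.map ι.toRatAlgHom P = heegnerPointComplex Dt H) (hc : ¬ (p : ℤ) ∣ Dt.c) :
    (2 * padicValNat p (AddSubgroup.zmultiples P).index : ℤ) ≤
      padicValNat p (V.baseChange K).shaOrder + padicValNat p V.tamagawaProduct +
        padicValNat p W.tamagawaProduct + 2 * padicValNat p (Units.torsionOrder K) := by
  have hr0 : V.analyticRank = 0 := (V.analyticRank_eq_zero_iff_holds (hmod V)).2 hLV
  have hu : padicValRat p (Cd.u : ℚ) = 0 :=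
    padicValRat_u_eq_zero_of_good_of_twist_discr_eq_neg V W p hp2 hVgood K hdisc Cd hCd
  exact twist_indexBound_units_of_missingLowerBounds V p N K Dt H ι P hGZ hKo hGZK hmod hK hHN hP hp2 hc hr0 hLV0
    W Cd hCd hu hr hLW

end Summit.BirchSwinnertonDyer.BirchSwinnertonDyer.Theorems.AdditiveBranchIMCGordTwoRankOne.HeegnerKolyvagin

end
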